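import Literature.IUT.HodgeTheaters.InitialThetaDataOfModel
import Literature.IUT.HodgeTheaters.ImageContainsSL2Bridge
import Literature.IUT.LogVolume.PrincipalArithmeticDivisors
import Literature.NumberTheory.EllipticCurves.MultiplicativeReductionJValuationProofs
import Literature.NumberTheory.DiophantineGeometry.GenEllMellReduction
import Literature.NumberTheory.DiophantineGeometry.GenEllImageModLContainsSL2
import HarnessLib

/-!
# [IUTchIV] Cor. 2.2 (ii), step (P7): the bad places `𝕍^bad_mod` of (P5) and the clauses of [IUTchI] Def. 3.1
# (b)(c) at them for `E_F = W ⊗ F` — `BadPlaceInput` and initial Θ-data from `F`-level `j`-adic data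

Mochizuki, *Inter-universal Teichmüller theory IV*, RIMS manuscript (Apr. 2020; = PRIMS **57** (2021)),
Cor. 2.2 (ii), proof, p. 45 (P2) "`l` does not divide any nonzero `h_v`"; p. 46 (P5) "`𝕍^bad_mod` … the
nonarchimedean valuations ∈ 𝕍(F_mod) that do not divide `2l` and at which `E_F` has bad multiplicative
reduction, then `𝕍^bad_mod ≠ ∅`", (P6), and "… '`𝕍^bad_mod`' to be the set `𝕍^bad_mod` of (P5), then … all of the
conditions of [IUTchI], Definition 3.1, (a)–(f), are satisfied"; [IUTchI] Def. 3.1 (b)(c), pp. 61–62.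

THIS FILE completes the arithmetic half of the route's child (i) «ThetaDataExists» (crux `ThetaPartII`, route
definition item D1; companion of `InitialThetaDataOfModel.lean`, `ThetaDataField.lean`,
`InitialThetaDataArith.lean`) for `E_F := W ⊗_{F_mod} F`, `F := F_mod(√−1, W[2·3·5])`, `W` a model over
`F_mod = ℚ(j(W))`: from the `F`-LEVEL data `PlaceInput` — a prime `l ≥ 7`, ONE (P5) place `w` of `F` (bad
multiplicative reduction, `2, l ∉ w`), (P2) at the (P5) places (`l ∤ ord_w(j) = −h_w`), and (P6) over `F` — it
DEFINES `𝕍^bad_mod :=` the places of `F_mod` below the (P5) places (`VbadModOf`) and PROVES every place clause of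
Def. 3.1 (b)(c): nonempty; odd residue characteristic and `≠ l` (residue field of `F_mod` embeds into `𝓞_F/w`);
**bad multiplicative reduction at EVERY place of `F` over `𝕍^bad_mod`** (conjugate places over the same place of
`F_mod` see `ord(j) = e·ord_u(j)` of the same sign since `j ∈ F_mod`; semistable + `ord(j) < 0` ⟹ multiplicative);
**`l` prime to `ord_v(q) = ord_v(Δ_min)` there** (`= −ord_v(j) = e(v|u)·(−ord_u(j))`, `l ∤ ord_u(j)` by (P2) at the
(P5) place, `l ∤ e(v|u) ∣ [F : F_mod] ∣ 2·6·48·480` by `IsGalois`); and (P6) in L5-t2's typing from (P4) "no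
`l`-cyclic subgroup scheme" + the (P5) place (`imageContainsSL2_of_not_admitsLCyclic`: abc-iut-S-d4's
`imageModLContainsSL2_of_not_admitsLCyclic_of_hasMultiplicativeReductionAt` + abc-iut-L5-t12's bridge). RESULT:
`exists_initialThetaData_ofPlaceInput`. What the campaign-S point dictionary still supplies at a λ-line point:
an `F_mod`-model `W` of `E_λ`, one (P5) place and (P2) read in `F` (along `F_tpd ⊆ F`: `ord` scales by a positive
ramification index prime to `l`), and (P4) from the height threshold. Classical; no side taken on [IUTchIII]
Cor. 3.12; nothing printed is asserted.
-/

noncomputable section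

open scoped Classical
open Field IntermediateField NumberField IsDedekindDomain
open Literature.NumberTheory.EllipticCurves Literature.IUT.LogVolume

universe u

namespace Literature.IUT.HodgeTheaters

variable {K₀ : Type u} [Field K₀] [NumberField K₀] (W : WeierstrassCurve K₀) [W.IsElliptic]

/-! ## `j(E_F)` as an element of the field of moduli; valuations in the tower `F_mod ⊆ F` -/

/-- `j(E_F) ∈ ℚ(j(E_F)) = F_mod`. [claim: Mochizuki2012, status: disputed] -/
def jMod : fieldOfModuli (modelCurve W) :=
  ⟨(modelCurve W).j, IntermediateField.mem_adjoin_simple_self ℚ _⟩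

/-- `j(E_F) = algebraMap F_mod F (jMod)`. [claim: Mochizuki2012, status: disputed] -/
theorem algebraMap_jMod : algebraMap (fieldOfModuli (modelCurve W)) (ThetaF W) (jMod W) = (modelCurve W).j :=
  rfl

/-- **`ord_v(j) = e(v|u)·ord_u(j)`** for `v` a finite place of `F` over the place `u` of `F_mod` (`j ∈ F_mod`).
[claim: Mochizuki2012, status: disputed] -/
theorem ord_j_eq_mul (v : HeightOneSpectrum (𝓞 (ThetaF W))) :
    ord (ThetaF W) v (modelCurve W).j =
      Ideal.ramificationIdx' (finBelow (fieldOfModuli (modelCurve W)) (ThetaF W) v).asIdeal v.asIdeal *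
        ord (fieldOfModuli (modelCurve W)) (finBelow (fieldOfModuli (modelCurve W)) (ThetaF W) v) (jMod W) := by
  rw [← algebraMap_jMod W, ord_algebraMap]

/-- The ramification index of a finite place is positive. [claim: Mochizuki2012, status: disputed] -/
theorem ramificationIdx'_pos (v : HeightOneSpectrum (𝓞 (ThetaF W))) :
    0 < Ideal.ramificationIdx' (finBelow (fieldOfModuli (modelCurve W)) (ThetaF W) v).asIdeal v.asIdeal := by
  haveI := v.isPrime
  exact Nat.pos_of_ne_zero (Ideal.IsDedekindDomain.ramificationIdx'_ne_zero_of_liesOver v.asIdeal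
    (finBelow (fieldOfModuli (modelCurve W)) (ThetaF W) v).ne_bot)

/-- For a positive `e`: `e·x < 0 ↔ x < 0`. [claim: Mochizuki2012, status: disputed] -/
theorem mul_neg_iff_of_pos {e x : ℤ} (he : 0 < e) : e * x < 0 ↔ x < 0 :=
  ⟨fun h => by by_contra hx; exact absurd h (not_lt.mpr (mul_nonneg he.le (not_lt.mp hx))),
    fun hx => mul_neg_of_pos_of_neg he hx⟩

/-- Places of `F` over the SAME place of `F_mod` see the same sign of `ord(j)` (`j ∈ F_mod`).
[claim: Mochizuki2012, status: disputed] -/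
theorem ord_j_neg_iff_of_finBelow_eq {v w : HeightOneSpectrum (𝓞 (ThetaF W))}
    (h : finBelow (fieldOfModuli (modelCurve W)) (ThetaF W) v =
      finBelow (fieldOfModuli (modelCurve W)) (ThetaF W) w) :
    ord (ThetaF W) v (modelCurve W).j < 0 ↔ ord (ThetaF W) w (modelCurve W).j < 0 := by
  rw [ord_j_eq_mul W v, ord_j_eq_mul W w, h,
    mul_neg_iff_of_pos (by exact_mod_cast (h ▸ ramificationIdx'_pos W v)),
    mul_neg_iff_of_pos (by exact_mod_cast ramificationIdx'_pos W w)]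

/-- **Semistable + `ord_v(j) < 0` ⟹ multiplicative reduction at `v`** (good reduction forces `|j|_v ≤ 1`,
Silverman AEC VII.5.1; the tree's `valuation_j_le_one_of_hasGoodReduction_localMinimalModel`).
[claim: Mochizuki2012, status: disputed] -/
theorem hasMultiplicativeReductionAt_of_ord_j_neg {F : Type u} [Field F] [NumberField F]
    (E : WeierstrassCurve F) [E.IsElliptic] (hss : E.IsSemistable (𝓞 F)) {v : HeightOneSpectrum (𝓞 F)}
    (hv : ord F v E.j < 0) : E.HasMultiplicativeReductionAt v := by
  rcases hss v with hgood | hmult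
  · exfalso
    have hle : v.valuation F E.j ≤ 1 :=
      Literature.NumberTheory.DiophantineGeometry.GenEll.valuation_j_le_one_of_hasGoodReduction_localMinimalModel
        v E hgood
    have hj : E.j ≠ 0 := by
      intro h0; rw [h0, ord_zero] at hv; exact lt_irrefl _ hv
    have hne : v.valuation F E.j ≠ 0 := (Valuation.ne_zero_iff _).mpr hj
    have hlog : WithZero.log (v.valuation F E.j) ≤ 0 := by
      rw [WithZero.log_le_iff_le_exp hne]; simpa using hle
    unfold ord at hv
    omega
  · exact hmult

/-- At a place of multiplicative reduction `ord_v(j) = −ord_v(Δ_min) < 0` (Silverman AEC VII.5.1 (b); the tree's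
`log_valuation_j_eq_ordMinimalDiscriminant_of_hasMultiplicativeReductionAt`). [claim: Mochizuki2012, status: disputed] -/
theorem ord_j_neg_of_hasMultiplicativeReductionAt' {F : Type u} [Field F] [NumberField F]
    (E : WeierstrassCurve F) [E.IsElliptic] {v : HeightOneSpectrum (𝓞 F)}
    (hv : E.HasMultiplicativeReductionAt v) : ord F v E.j < 0 := by
  have h := E.log_valuation_j_eq_ordMinimalDiscriminant_of_hasMultiplicativeReductionAt v hv
  have hne : E.ordMinimalDiscriminant v ≠ 0 := fun h0 =>
    hv.not_hasGoodReductionAt ((WeierstrassCurve.ordMinimalDiscriminant_eq_zero_iff_holds v E).mp h0)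
  unfold ord
  rw [h]
  have : (0 : ℤ) < E.ordMinimalDiscriminant v := by exact_mod_cast Nat.pos_of_ne_zero hne
  omega

/-! ## The (P5) bad places of `F`, their images `V^bad_mod` in `F_mod`, and the Def. 3.1 (b)(c) clauses -/

/-- The (P5) places of `F` for the prime `l`: bad multiplicative reduction, not over `2`, not over `l`
([IUTchIV] Cor. 2.2 (ii), (P5), p. 46: "the nonarchimedean valuations … that do not divide `2l` and at which
`E_F` has bad multiplicative reduction"). [claim: Mochizuki2012, status: disputed] -/
def badSet (l : ℕ) : Set (HeightOneSpectrum (𝓞 (ThetaF W))) :=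
  {w | (modelCurve W).HasMultiplicativeReductionAt w ∧ ((2 : ℕ) : 𝓞 (ThetaF W)) ∉ w.asIdeal ∧
    ((l : ℕ) : 𝓞 (ThetaF W)) ∉ w.asIdeal}

/-- `𝕍^bad_mod :=` the places of `F_mod` below the (P5) places of `F` ((P5): "`𝕍^bad_mod` … of `F_mod`").
[claim: Mochizuki2012, status: disputed] -/
def VbadModOf (l : ℕ) : Set (FinitePlace (fieldOfModuli (modelCurve W))) :=
  (fun w => InitialThetaData.finBelow (E := modelCurve W) (FinitePlace.mk w)) '' badSet W l

/-- Restriction of a nonarchimedean valuation of `F` to `F_mod` is the place below it.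
[claim: Mochizuki2012, status: disputed] -/
theorem restrict_non_eq (x : FinitePlace (ThetaF W)) :
    Val.restrict (fieldOfModuli (modelCurve W)) (Val.non x) =
      Val.non (InitialThetaData.finBelow (E := modelCurve W) x) := rfl

/-- A place of `F` restricts into `Val.non '' 𝕍^bad_mod` iff it lies over the same place of `F_mod` as some
(P5) place. [claim: Mochizuki2012, status: disputed] -/
theorem restrict_mem_iff {l : ℕ} (x : FinitePlace (ThetaF W)) :
    Val.restrict (fieldOfModuli (modelCurve W)) (Val.non x) ∈ Val.non '' VbadModOf W l ↔
      ∃ w ∈ badSet W l, InitialThetaData.finBelow (E := modelCurve W) x =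
        InitialThetaData.finBelow (E := modelCurve W) (FinitePlace.mk w) := by
  rw [restrict_non_eq]
  constructor
  · rintro ⟨u, ⟨w, hw, rfl⟩, hu⟩
    exact ⟨w, hw, (Sum.inr_injective hu).symm⟩
  · rintro ⟨w, hw, h⟩
    exact ⟨_, ⟨w, hw, rfl⟩, congrArg Val.non h.symm⟩

/-- Equal places below in `F_mod` (as `FinitePlace`s) give equal primes below in `𝓞 F_mod`.
[claim: Mochizuki2012, status: disputed] -/
theorem finBelow_eq_of_finBelow_mk_eq {x : FinitePlace (ThetaF W)} {w : HeightOneSpectrum (𝓞 (ThetaF W))}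
    (h : InitialThetaData.finBelow (E := modelCurve W) x =
      InitialThetaData.finBelow (E := modelCurve W) (FinitePlace.mk w)) :
    finBelow (fieldOfModuli (modelCurve W)) (ThetaF W) x.maximalIdeal =
      finBelow (fieldOfModuli (modelCurve W)) (ThetaF W) w := by
  unfold InitialThetaData.finBelow at h
  have h' := congrArg FinitePlace.maximalIdeal h
  rw [FinitePlace.maximalIdeal_mk, FinitePlace.maximalIdeal_mk, FinitePlace.maximalIdeal_mk] at h'
  exact h'

/-- **(b) bad multiplicative reduction of `E_F` at EVERY place of `F` over `𝕍^bad_mod`** (not only at the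
(P5) places themselves: conjugate places over the same place of `F_mod` have `ord(j)` of the same sign, and
`E_F` is semistable). [claim: Mochizuki2012, status: disputed] -/
theorem multiplicative_over_VbadModOf {l : ℕ} (x : FinitePlace (ThetaF W))
    (hx : Val.restrict (fieldOfModuli (modelCurve W)) (Val.non x) ∈ Val.non '' VbadModOf W l) :
    (modelCurve W).HasMultiplicativeReductionAt x.maximalIdeal := by
  obtain ⟨w, hw, h⟩ := (restrict_mem_iff W x).mp hx
  have hss : (modelCurve W).IsSemistable (𝓞 (ThetaF W)) :=
    (modelCurve W).isSemistable_of_torsion_rational_fifteen fun P hP => by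
      have h30 : (30 : ℤ) • P = 0 := by
        rw [show (30 : ℤ) = 2 * 15 by norm_num, mul_smul, hP, smul_zero]
      exact torsion_thirty_rational W P h30
  refine hasMultiplicativeReductionAt_of_ord_j_neg (modelCurve W) hss ?_
  rw [ord_j_neg_iff_of_finBelow_eq W (finBelow_eq_of_finBelow_mk_eq W h)]
  exact ord_j_neg_of_hasMultiplicativeReductionAt' (modelCurve W) hw.1

/-- In the Galois extension `F/F_mod` the ramification index `e(v|u)` divides `[F : F_mod]`.
[claim: Mochizuki2012, status: disputed] -/
theorem ramificationIdx'_dvd_finrank (hgen : IntermediateField.adjoin ℚ {W.j} = ⊤)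
    (v : HeightOneSpectrum (𝓞 (ThetaF W))) :
    Ideal.ramificationIdx' (finBelow (fieldOfModuli (modelCurve W)) (ThetaF W) v).asIdeal v.asIdeal ∣
      Module.finrank (fieldOfModuli (modelCurve W)) (ThetaF W) := by
  haveI := isGalois_fieldOfModuli_modelCurve W hgen
  set u := finBelow (fieldOfModuli (modelCurve W)) (ThetaF W) v
  haveI := v.isPrime
  haveI := u.isPrime
  rw [Ideal.ramificationIdx'_eq_ramificationIdx (p := u.asIdeal) (q := v.asIdeal) u.ne_bot]
  have h := Ideal.ncard_primesOver_mul_ramificationIdxIn_mul_inertiaDegIn u.asIdeal (𝓞 (ThetaF W))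
    Gal(ThetaF W/fieldOfModuli (modelCurve W))
  rw [Ideal.ramificationIdxIn_eq_ramificationIdx u.asIdeal v.asIdeal Gal(ThetaF W/fieldOfModuli (modelCurve W)),
    IsGaloisGroup.card_eq_finrank Gal(ThetaF W/fieldOfModuli (modelCurve W))
      (fieldOfModuli (modelCurve W)) (ThetaF W)] at h
  exact ⟨(u.asIdeal.primesOver (𝓞 (ThetaF W))).ncard * u.asIdeal.inertiaDegIn (𝓞 (ThetaF W)),
    by rw [← h]; ring⟩

/-- **(c) `l` is prime to the local heights `ord_v(q) = ord_v(Δ_min)` at every place over `𝕍^bad_mod`**, from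
(P2) at the (P5) places: over the common place `u` of `F_mod`, `ord_v(j) = e(v|u)·ord_u(j)` with `l ∤ ord_u(j)`
and `l ∤ e(v|u) ∣ [F:F_mod]` (`l ≥ 7`). [claim: Mochizuki2012, status: disputed] -/
theorem l_coprime_qParamOrd_of (hgen : IntermediateField.adjoin ℚ {W.j} = ⊤) {l : ℕ} (hl : l.Prime)
    (h7 : 7 ≤ l)
    (hP2 : ∀ w ∈ badSet W l, ¬ ((l : ℤ) ∣ ord (ThetaF W) w (modelCurve W).j))
    (x : FinitePlace (ThetaF W))
    (hx : Val.restrict (fieldOfModuli (modelCurve W)) (Val.non x) ∈ Val.non '' VbadModOf W l) :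
    l.Coprime (qParamOrd (modelCurve W) x.maximalIdeal) := by
  obtain ⟨w, hw, h⟩ := (restrict_mem_iff W x).mp hx
  have hmult := multiplicative_over_VbadModOf W x hx
  rw [Nat.Prime.coprime_iff_not_dvd hl]
  intro hdvd
  -- `l ∣ ord(Δ_min) = −ord_x(j)`
  have hlog : (l : ℤ) ∣ WithZero.log ((x.maximalIdeal).valuation (ThetaF W) (modelCurve W).j) :=
    ((modelCurve W).natCast_dvd_log_valuation_j_iff x.maximalIdeal hmult l).mpr hdvd
  have hordx : (l : ℤ) ∣ ord (ThetaF W) x.maximalIdeal (modelCurve W).j := by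
    unfold ord; exact (dvd_neg).mpr hlog
  -- decompose along the common place below
  have hbelow := finBelow_eq_of_finBelow_mk_eq W h
  rw [ord_j_eq_mul W x.maximalIdeal, hbelow] at hordx
  have hordw := hP2 w hw
  rw [ord_j_eq_mul W w] at hordw
  -- `l ∤ ord_u(j)`
  have hu : ¬ ((l : ℤ) ∣ ord (fieldOfModuli (modelCurve W))
      (finBelow (fieldOfModuli (modelCurve W)) (ThetaF W) w) (jMod W)) :=
    fun hd => hordw (dvd_mul_of_dvd_right hd _)
  -- `l ∤ e(x|u)`
  have he : ¬ ((l : ℤ) ∣ (Ideal.ramificationIdx'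
      (finBelow (fieldOfModuli (modelCurve W)) (ThetaF W) x.maximalIdeal).asIdeal x.maximalIdeal.asIdeal : ℤ)) := by
    intro hd
    have hd' : l ∣ Ideal.ramificationIdx'
        (finBelow (fieldOfModuli (modelCurve W)) (ThetaF W) x.maximalIdeal).asIdeal x.maximalIdeal.asIdeal := by
      exact_mod_cast hd
    have hfin := (ramificationIdx'_dvd_finrank W hgen x.maximalIdeal)
    have hcop := finrank_fieldOfModuli_coprime W hgen hl h7
    have : l ∣ Module.finrank (fieldOfModuli (modelCurve W)) (ThetaF W) := hd'.trans hfin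
    exact (Nat.Prime.coprime_iff_not_dvd hl).mp hcop.symm this
  rw [hbelow] at he
  have hprime : Prime (l : ℤ) := Int.prime_iff_natAbs_prime.mpr (by simpa using hl)
  rcases hprime.dvd_or_dvd hordx with h1 | h2
  · exact he h1
  · exact hu h2


/-! ## Residue characteristics at the bad places: odd and `≠ l` -/

/-- The residue characteristic of the place of `F_mod` below a finite place `w` of `F` equals the characteristic
of `𝓞_F / w` (the residue field extension is injective). [claim: Mochizuki2012, status: disputed] -/
theorem residueChar_finBelow_eq (w : HeightOneSpectrum (𝓞 (ThetaF W))) :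
    residueChar (InitialThetaData.finBelow (E := modelCurve W) (FinitePlace.mk w)) =
      ringChar (𝓞 (ThetaF W) ⧸ w.asIdeal) := by
  unfold residueChar InitialThetaData.finBelow
  rw [FinitePlace.maximalIdeal_mk, FinitePlace.maximalIdeal_mk]
  -- the residue ring of `F_mod` at the place below embeds into `𝓞_F / w`
  change ringChar (𝓞 (fieldOfModuli (modelCurve W)) ⧸ w.asIdeal.under (𝓞 (fieldOfModuli (modelCurve W)))) = _
  have hinj : Function.Injective (algebraMap
      (𝓞 (fieldOfModuli (modelCurve W)) ⧸ w.asIdeal.under (𝓞 (fieldOfModuli (modelCurve W))))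
      (𝓞 (ThetaF W) ⧸ w.asIdeal)) :=
    FaithfulSMul.algebraMap_injective _ _
  haveI : CharP (𝓞 (ThetaF W) ⧸ w.asIdeal) (ringChar (𝓞 (ThetaF W) ⧸ w.asIdeal)) := ringChar.charP _
  haveI := (RingHom.charP_iff _ hinj (ringChar (𝓞 (ThetaF W) ⧸ w.asIdeal))).mpr this
  exact ringChar.eq _ (ringChar (𝓞 (ThetaF W) ⧸ w.asIdeal))

omit [NumberField K₀] [W.IsElliptic] in
/-- `(n : 𝓞_F/w) = 0 ↔ n ∈ w`. [claim: Mochizuki2012, status: disputed] -/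
theorem natCast_quotient_eq_zero_iff (w : HeightOneSpectrum (𝓞 (ThetaF W))) (n : ℕ) :
    ((n : ℕ) : 𝓞 (ThetaF W) ⧸ w.asIdeal) = 0 ↔ ((n : ℕ) : 𝓞 (ThetaF W)) ∈ w.asIdeal := by
  rw [← map_natCast (Ideal.Quotient.mk w.asIdeal), Ideal.Quotient.eq_zero_iff_mem]

/-- The characteristic of `𝓞_F/w` is an odd prime when `2 ∉ w`. [claim: Mochizuki2012, status: disputed] -/
theorem odd_ringChar_quotient (w : HeightOneSpectrum (𝓞 (ThetaF W)))
    (h2 : ((2 : ℕ) : 𝓞 (ThetaF W)) ∉ w.asIdeal) : Odd (ringChar (𝓞 (ThetaF W) ⧸ w.asIdeal)) := by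
  set R := 𝓞 (ThetaF W) ⧸ w.asIdeal
  set p := ringChar R with hp
  haveI := w.isMaximal
  -- `p ≠ 0`: the (nonzero) absolute norm of `w` dies in `R`
  have hN : ((Ideal.absNorm w.asIdeal : ℕ) : R) = 0 := by
    rw [← map_natCast (Ideal.Quotient.mk w.asIdeal), Ideal.Quotient.eq_zero_iff_mem]
    exact Ideal.absNorm_mem w.asIdeal
  have hN0 : Ideal.absNorm w.asIdeal ≠ 0 := by
    rw [Ne, Ideal.absNorm_eq_zero_iff]; exact w.ne_bot
  have hp0 : p ≠ 0 := by
    intro h0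
    rw [ringChar.spec, ← hp, h0, zero_dvd_iff] at hN
    exact hN0 hN
  have hprime : p.Prime := (CharP.char_is_prime_or_zero R p).resolve_right hp0
  have hp2 : p ≠ 2 := by
    intro h
    have : ((2 : ℕ) : R) = 0 := by rw [ringChar.spec, ← hp, h]
    exact h2 ((natCast_quotient_eq_zero_iff W w 2).mp this)
  exact hprime.odd_of_ne_two hp2

omit [NumberField K₀] [W.IsElliptic] in
/-- The characteristic of `𝓞_F/w` is not `l` when `l ∉ w`. [claim: Mochizuki2012, status: disputed] -/
theorem ringChar_quotient_ne (w : HeightOneSpectrum (𝓞 (ThetaF W))) {l : ℕ}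
    (hl : ((l : ℕ) : 𝓞 (ThetaF W)) ∉ w.asIdeal) : ringChar (𝓞 (ThetaF W) ⧸ w.asIdeal) ≠ l := by
  intro h
  have : ((l : ℕ) : 𝓞 (ThetaF W) ⧸ w.asIdeal) = 0 := by rw [ringChar.spec, h]
  exact hl ((natCast_quotient_eq_zero_iff W w l).mp this)

/-- **(b) odd residue characteristics on `𝕍^bad_mod`** ((P5): the bad places do not divide `2`).
[claim: Mochizuki2012, status: disputed] -/
theorem VbadModOf_odd {l : ℕ} (u : FinitePlace (fieldOfModuli (modelCurve W))) (hu : u ∈ VbadModOf W l) :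
    Odd (residueChar u) := by
  obtain ⟨w, hw, rfl⟩ := hu
  rw [residueChar_finBelow_eq]
  exact odd_ringChar_quotient W w hw.2.1

/-- **(c) `l` is prime to the residue characteristics of `𝕍^bad_mod`** ((P5): the bad places do not divide `l`).
[claim: Mochizuki2012, status: disputed] -/
theorem VbadModOf_ne_l {l : ℕ} (u : FinitePlace (fieldOfModuli (modelCurve W))) (hu : u ∈ VbadModOf W l) :
    residueChar u ≠ l := by
  obtain ⟨w, hw, rfl⟩ := hu
  rw [residueChar_finBelow_eq]
  exact ringChar_quotient_ne W w hw.2.2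

/-! ## (P6) over `F` from (P4) + a (P5) place ([IUTchIV] p. 46; abc-iut-S-d4's route), in L5-t2's typing -/

/-- **(P6) for `E_F` over `F`**: no `l`-cyclic subgroup scheme ((P4), supplied by the height threshold of the
campaign-S dictionary) and one (P5) place with (P2) give `SL₂(𝔽_l) ⊆ Im(G_F)` on `E_F[l]` ([GenEll] Lem. 3.1
(iii) + the Tate-curve transvection: abc-iut-S-d4 / S5), converted to the typing of `InitialThetaData` by
abc-iut-L5-t12's bridge. (Universe `0`: the [GenEll] `EllPoint` vocabulary.) [claim: Mochizuki2012, status: disputed] -/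
theorem imageContainsSL2_of_not_admitsLCyclic {K₀ : Type} [Field K₀] [NumberField K₀] (W : WeierstrassCurve K₀)
    [W.IsElliptic] {l : ℕ} [Fact l.Prime]
    (hno : ¬ (Literature.NumberTheory.DiophantineGeometry.GenEll.EllPoint.mk (ThetaF W) (modelCurve W)).AdmitsLCyclic l)
    {w : HeightOneSpectrum (𝓞 (ThetaF W))} (hw : (modelCurve W).HasMultiplicativeReductionAt w)
    (hwl : ((l : ℕ) : 𝓞 (ThetaF W)) ∉ w.asIdeal) (hP2 : ¬ ((l : ℤ) ∣ ord (ThetaF W) w (modelCurve W).j)) :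
    ImageContainsSL2 (AlgebraicClosure (ThetaF W)) (modelCurve W) l := by
  haveI : NeZero l := ⟨(Fact.out : l.Prime).ne_zero⟩
  refine imageContainsSL2_of_imageModLContainsSL2 (modelCurve W) l ?_
  refine Literature.NumberTheory.DiophantineGeometry.GenEll.EllPoint.imageModLContainsSL2_of_not_admitsLCyclic_of_hasMultiplicativeReductionAt
    _ l hno hw hwl ?_
  intro hdvd
  apply hP2
  have hlog := ((modelCurve W).natCast_dvd_log_valuation_j_iff w hw l).mpr hdvd
  unfold ord
  exact (dvd_neg).mpr hlog

/-! ## Assembly -/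

/-- The `F`-level inputs of (P7): `l ≥ 7` prime, ONE (P5) place, (P2) at the (P5) places, (P6) over `F`
(obtainable from (P4) by `imageContainsSL2_of_not_admitsLCyclic`). [claim: Mochizuki2012, status: disputed] -/
structure PlaceInput (l : ℕ) where
  /-- `l` prime -/
  l_prime : l.Prime
  /-- `l ≥ 7` -/
  seven_le_l : 7 ≤ l
  /-- (P5): some bad multiplicative place of `F` not dividing `2l` -/
  exists_bad : (badSet W l).Nonempty
  /-- (P2) at the (P5) places: `l ∤ ord_w(j) = −h_w` -/
  not_dvd_ord : ∀ w ∈ badSet W l, ¬ ((l : ℤ) ∣ ord (ThetaF W) w (modelCurve W).j)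
  /-- (P6) over `F` -/
  imageContainsSL2 : ImageContainsSL2 (AlgebraicClosure (ThetaF W)) (modelCurve W) l

/-- **`BadPlaceInput` from the `F`-level (P2)/(P5)/(P6) data**: `𝕍^bad_mod :=` the places of `F_mod` below the
(P5) places; nonempty, odd, `∤ l`; bad multiplicative reduction at EVERY place of `F` over it; `l` prime to the
local heights there. [claim: Mochizuki2012, status: disputed] -/
def badPlaceInputOf (hgen : IntermediateField.adjoin ℚ {W.j} = ⊤) {l : ℕ} (I : PlaceInput W l) :
    BadPlaceInput W l where
  VbadMod := VbadModOf W l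
  VbadMod_nonempty := by
    obtain ⟨w, hw⟩ := I.exists_bad
    exact ⟨_, w, hw, rfl⟩
  VbadMod_odd := fun u hu => VbadModOf_odd W u hu
  multiplicative_over_VbadMod := fun v hv => multiplicative_over_VbadModOf W v hv
  l_prime := I.l_prime
  seven_le_l := I.seven_le_l
  imageContainsSL2 := I.imageContainsSL2
  l_ne_residueChar := fun u hu => VbadModOf_ne_l W u hu
  l_coprime_qParamOrd := fun v hv =>
    l_coprime_qParamOrd_of W hgen I.l_prime I.seven_le_l I.not_dvd_ord v hv

/-- **[IUTchIV] Cor. 2.2 (ii) (P7), arithmetic half, from `F`-level data — EXISTENCE of initial Θ-data on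
`E_F = W ⊗ F` with `𝕍^bad_mod` = the places of `F_mod` under the (P5) places**, for a model `W` over
`F_mod = ℚ(j(W))`, modulo the `π₁`-geometry interface of Def. 3.1 (d)(e)(f) only. The route's layer-2 child (i)
«ThetaDataExists(P, l)» at a λ-line point is this theorem applied to an `F_mod`-model of `E_λ` with the
`PlaceInput` read off (P2), (P5) (campaign-S dictionary along `F_tpd ⊆ F`) and (P6)/(P4).
[claim: Mochizuki2012, status: disputed] -/
theorem exists_initialThetaData_ofPlaceInput (hgen : IntermediateField.adjoin ℚ {W.j} = ⊤) {l : ℕ}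
    [NeZero l] (I : PlaceInput W l)
    (Pb : BadPlacePredicates (TorsionField (modelCurve W) l))
    (geom : ThetaGeometry.{u} (AlgebraicClosure (ThetaF W) ≃ₐ[ThetaF W] AlgebraicClosure (ThetaF W))
      (galoisSubgroupOf (ThetaF W) (TorsionField (modelCurve W) l) (AlgebraicClosure (ThetaF W))) l)
    (hbad_type : ∀ w : Val (TorsionField (modelCurve W) l),
      toVMod (ThetaF W) (TorsionField (modelCurve W) l) (modelCurve W) w ∈ Val.non '' VbadModOf W l →
        Pb.IsTypeOneZModLPM w)
    (hbad_cusp : ∀ w : Val (TorsionField (modelCurve W) l),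
      toVMod (ThetaF W) (TorsionField (modelCurve W) l) (modelCurve W) w ∈ Val.non '' VbadModOf W l →
        Pb.IsCanonicalGeneratorCusp w) :
    ∃ D : InitialThetaData (ThetaF W) (TorsionField (modelCurve W) l) (AlgebraicClosure (ThetaF W))
        (modelCurve W) l Pb, D.VbadMod = VbadModOf W l :=
  exists_initialThetaData_ofModel W hgen (badPlaceInputOf W hgen I) Pb geom hbad_type hbad_cusp


end Literature.IUT.HodgeTheaters

end
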